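import Summits.Langlands.Langlands.Theorems.CliffordOrbitSplitPrelude
import Summits.Langlands.Langlands.Theses.PerfectLayerClifford

/-!
# `CliffordOrbitSplit` — lens-4 («minimal counterexample / extremal reduction») g31 node, landing part 2/2 (pieces + kernel); part 1 = `CliffordOrbitSplitPrelude`

«THE RESIDUAL HAS AN ORBIT TYPE, AND A PERFECT GROUP HAS NO SMALL ORBITS.»

TARGET (BY NAME) = RED° = `Summit.Langlands.Langlands.Theses.PerfectLayerClifford.ReduciblePerfectDescent` (sha12 `dc1b1d2efc14`) = the live
ledger item stmt-Langlands-27357, the tribunal-named RESIDUAL (rank 5) of route-Langlands-PerfectLayerClifford (rev 0, OPEN since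
2026-08-31T13:33Z, verdict SPLIT-WITH-RESIDUAL, residual = [27357]): reciprocity for a cuspidal L-algebraic `π` on `GL_n/K` whose Satake
parameters are NOT a.e. of power-finite ratio, ACROSS a Galois layer `L/K` with no cyclic sub-layer of prime degree, GIVEN a semisimple but
REDUCIBLE relative avatar `r : Γ_L → GL_n(ℚ̄_ℓ)` of `π`.  Nobody has cut RED° (the lineage cut RIGID twice, g29/g30, and EXT, g26/g28).

## The dial (lives on `r`, defined everywhere by the tree's `relAvatar_invariant`)

By `TatePhantomLift.relAvatar_invariant` (Chebotarev + Brauer–Nesbitt, PROVED in the tree) the relative avatar is `Γ_K`-INVARIANT: for every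
`τ ∈ Γ_K` there is an intertwiner `P_τ ∈ GL_n` with `P_τ · r^τ · P_τ⁻¹ = r`.  Conjugation by `P_τ` preserves the commutant
`C(r) = {f | f r(σ) = r(σ) f}` and its centre `Z(C(r))`, and on `Z(C(r))` it does NOT depend on the choice of `P_τ` and is trivial on `res Γ_L`
(§2, all kernel-proved here): this is the CLIFFORD ACTION of `Gal(L/K)` on the centre of the commutant — for semisimple `r ≃ ⊕ᵢ mᵢσᵢ` it is the
permutation action `σᵢ ↦ σᵢ^τ` on the isomorphism classes of constituents (Wedderburn: `Z(C(r)) = ∏ᵢ ℚ̄_ℓ·eᵢ`).  Three cells: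
* **KRON** `IsotypicPerfectDescent` — `Z(C(r)) ⊆` scalars (one class: `r ≃ m·σ`, `m ≥ 2`, `σ` invariant).  The projective/Kronecker cell:
  by Tate's `H²(Γ_K, ℚ̄_ℓ^×) = 0` + Clifford, `ρ` (if it exists) is `ρ₁ ⊗ A` with `ρ₁|_L ≃ σ ⊗ χ` and `A` an irreducible PROJECTIVE-Artin
  representation of `Gal(L/K)` of degree `m` lifted to `Γ_K`.  IDEA-NEEDED (the avatar of `π` must be recognised as a tensor product).
* **STAB** `StableConstituentDescent` — not isotypic, every class `Γ_K`-fixed (`≥ 2` distinct classes, all invariant).  The endoscopic cell: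
  `ρ` (if it exists) is a direct sum `⊕ ρᵢ ⊗ Aᵢ` over `K` although `π` is CUSPIDAL — excluded by nothing in the hypotheses (CAP-type shadows);
  IDEA-NEEDED (needs the irreducibility of avatars of cuspidal `π`, open in general).
* **MOV**  `MovingConstituentDescent` — some central element of `C(r)` is MOVED by the action, and is fixed by `Gal(L/F)` for an intermediate
  field `F` with `[F:K] ≤ n` (MEANING: `F` = field of the stabiliser of a moved primitive central idempotent `e`, `[F:K] = |orbit of e| ≤`
  number of classes `≤ n`; this bound is PART OF THE DIAL, typed, not derived — see «honest flags» below).  The non-normal-induction cell: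
  `ρ` (if it exists) is `Ind_{Γ_F}^{Γ_K}` of an `F`-descent, `F/K` NON-Galois of degree `≤ n` inside the perfect-type layer.
  DECIDED here for `n ≤ 4` (§4): the EXTREMAL LEMMA «a finite group with no normal subgroup of prime index has no subgroup of index 2, 3 or 4»
  (coset action `G → S₄`, sign character, `V₄ ◁ A₄` — kernel-proved in §1 by `decide` on `Perm (Fin 4)`) forbids the stabiliser, so the
  cell is EMPTY in rank `≤ 4`; the open part of MOV is rank `≥ 5` (`A₅ ⊂ Gal`, index-5 stabilisers: the icosahedral quintic cell).

KERNEL (0 sorry): `closes_target : KRON → STAB → MOV → RED°` BY NAME (the node's bare `closes` is not re-declared: registry-owned name) (partition by `by_cases`), exactness `red_iff_pieces : RED° ↔ KRON ∧ STAB ∧ MOV`,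
`movingAt_of_le_four : n ≤ 4 → MovingConstituentDescentAt n`, `moving_iff_from_five : MOV ↔ ∀ n ≥ 5, MOVAt n`, hence the sharpened kernel
`closes_from_five : KRON → STAB → (∀ n ≥ 5, MOVAt n) → RED°`; host edges `closes_route : EXT → RIGID → FINTYPE → KRON → STAB → MOV →
GaloisHullLift.PerfectHullDescent` (via the route's own `PerfectLayerClifford.closes`) and `*_of_langlands` (every piece is S-implied, via the
tree's `TatePhantomLift.perfect_of_langlands`).

HONEST FLAGS. (1) The three cells are a partition BY LOGIC (`ISO`, `¬ISO ∧ ¬MOVDIAL`, `MOVDIAL`); that `MOVDIAL` captures EVERY `r` with a moved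
constituent class (the bound `[F:K] ≤ n` always achievable) is Wedderburn structure theory of `Z(C(r))` (reduced, `≤ n` primitive idempotents),
stated here as MEANING, not kernel-certified — if it failed for some `r`, that `r` would sit in STAB, so no case is lost, only mis-labelled.
(2) The decided rung is vacuity-by-group-theory of the MOV dial in rank `≤ 4`; its content is the extremal lemma, not reciprocity.
(3) `ISO → ¬MOVDIAL` is proved (`not_moved_of_isotypic`), so KRON and MOV are disjoint; STAB is the declared complement.

Sources: A. H. Clifford, Representations induced in an invariant subgroup, Ann. of Math. 38 (1937) §§1–3 (bib Clifford1937); J. Tate (in J.-P. Serre,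
Modular forms of weight one and Galois representations, Durham 1977, Thm 4: `H²(Γ_K, ℚ/ℤ) = 0`) (bib SerreDurham1977); S. Patrikis,
Variations on a theorem of Tate, Mem. AMS 1238 (2019) = arXiv:1207.6724, §§1.0–2.1 (lifting projective representations, Clifford theory for Galois
representations) (bib Patrikis2019); B. Huppert, Endliche Gruppen I (1967), Kap. II §1 and Kap. IV (subgroups of small index; the `n!`-argument) (bib Huppert1967); the tree: `TatePhantomLift.relAvatar_invariant`,
`TwinRigiditySplit.no_normal_subgroup_of_prime_index`, `PerfectLayerClifford.closes`.
-/


set_option linter.dupNamespace false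
set_option linter.unusedVariables false
set_option linter.style.longLine false
set_option linter.unusedSectionVars false

namespace Summit.Langlands.Langlands.Theorems.CliffordOrbitSplit

open scoped BigOperators Topology Matrix Classical
open Filter Set Function
open Literature.NumberTheory.GaloisRepresentations Literature.NumberTheory.Automorphic
open IsDedekindDomain
open Summit.Langlands.Langlands.Theses
open Summit.Langlands.Langlands.Theorems.TatePhantomLift (relAvatar_invariant perfect_of_langlands conj_conj conj_one)
open Summit.Langlands.Langlands.Theorems.TwinRigiditySplit (no_normal_subgroup_of_prime_index)
open scoped NumberField Polynomial
open Equiv Equiv.Perm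

/-! ## §0 The pieces (texts = RED°'s text `dc1b1d2efc14` with the orbit dial inserted after the `¬PFIN` hypothesis; generated by `gen_node31.py`) -/

/-- **KRON · crux · IDEA-NEEDED · S-implied** — the ISOTYPIC cell of RED°: the centre of the commutant of the reducible semisimple relative
avatar `r` consists of scalars (`r ≃ m·σ`, one constituent class).  Strictly weaker than RED° (one Clifford cell); not decided by the portfolio:
descent needs the avatar of `π` to be a Kronecker product `ρ₁ ⊗ A` (Tate lifting + Clifford), `A` projective-Artin of `Gal(L/K)`.
Why it might fail: it does not fail modulo reciprocity (`isotypic_of_langlands`); unconditionally it is open (no automorphic tensor-product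
recognition for `GL_n`, `n = m·dim σ ≥ 4`). Sources: [ref: Clifford1937, §3], [ref: Patrikis2019, §§1.0–2.1], [ref: SerreDurham1977, Thm 4 (Tate)]. -/
def IsotypicPerfectDescent : Prop :=
  ∀ (K : Type) [Field K] [NumberField K] (n : ℕ) (hcpt : Literature.NumberTheory.Automorphic.isCompact_glFiniteIntegralLevel n K), 0 < n → ∀ (π : Literature.NumberTheory.Automorphic.CuspidalAutomorphicRepData n K hcpt), π.1.IsLAlgebraic → ∀ (L : Type) [Field L] [NumberField L] [Algebra K L], IsGalois K L → Module.finrank K L ≠ 1 → (¬ ∃ F : IntermediateField K L, F ≠ ⊥ ∧ IsGalois K ↥F ∧ IsCyclic (↥F ≃ₐ[K] ↥F) ∧ (Module.finrank K ↥F).Prime) → ∀ (ℓ : ℕ) [Fact ℓ.Prime] (ι : PadicAlgCl ℓ ≃+* ℂ) (r : Literature.NumberTheory.GaloisRepresentations.FramedGaloisRep L (PadicAlgCl ℓ) n), r.toGaloisRep.IsSemisimple → ¬ r.IsIrreducible → (¬ (∀ᶠ v : IsDedekindDomain.HeightOneSpectrum (NumberField.RingOfIntegers K) in cofinite, ∀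 α : Multiset ℂ, π.1.HasSatakeParamAt v α → ∀ a ∈ α, ∀ b ∈ α, ∃ k : ℕ, 0 < k ∧ a ^ k = b ^ k)) → (∀ f : Matrix (Fin n) (Fin n) (PadicAlgCl ℓ), ((∀ σ : Field.absoluteGaloisGroup L, f * ((r σ : GL (Fin n) (PadicAlgCl ℓ)) : Matrix (Fin n) (Fin n) (PadicAlgCl ℓ)) = ((r σ : GL (Fin n) (PadicAlgCl ℓ)) : Matrix (Fin n) (Fin n) (PadicAlgCl ℓ)) * f) ∧ ∀ f' : Matrix (Fin n) (Fin n) (PadicAlgCl ℓ), (∀ σ : Field.absoluteGaloisGroup L, f' * ((r σ : GL (Fin n) (PadicAlgCl ℓ)) : Matrix (Fin n) (Fin n) (PadicAlgCl ℓ)) = ((r σ : GL (Fin n) (PadicAlgCl ℓ)) : Matrix (Fin n) (Fin n) (PadicAlgCl ℓ)) * f') → f * f' = f' * f) → f ∈ Set.range (Matrix.scalar (Fin n) : PadicAlgCl ℓ → Matrix (Fin n) (Fin n) (PadicAlgCl ℓ))) → (∀ᶠ w : IsDedekindDomain.HeightOneSpectrum (NumberField.RingOfIntegers L) in cofinite,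 ∀ (v : IsDedekindDomain.HeightOneSpectrum (NumberField.RingOfIntegers K)) (α : Multiset ℂ), w.asIdeal.under (NumberField.RingOfIntegers K) = v.asIdeal → π.1.HasSatakeParamAt v α → r.IsUnramifiedAt w ∧ r.HasFrobCharpolyAt w (Literature.NumberTheory.Automorphic.arithFrobPolyOfSatake ι w.residueCard 1 (α.map (fun a => a ^ w.asIdeal.inertiaDeg (NumberField.RingOfIntegers K))))) → ∃ ρ : Literature.NumberTheory.GaloisRepresentations.FramedGaloisRep K (PadicAlgCl ℓ) n, ρ.toGaloisRep.IsSemisimple ∧ ∀ᶠ v : IsDedekindDomain.HeightOneSpectrum (NumberField.RingOfIntegers K) in cofinite, SatakeFrobCompatibleAt ι π.1 ρ v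

/-- **STAB · crux · IDEA-NEEDED · S-implied · declared complement** — the STABLE NON-ISOTYPIC cell of RED°: `Z(C(r))` is not scalar and the
moving dial is off (MEANING: `≥ 2` constituent classes, each fixed by `Γ_K`).  Strictly weaker than RED°; the endoscopic cell (a cuspidal `π`
whose `ℓ`-adic avatar would be a direct sum over `K`). Why it might fail: unconditionally open — it contains the irreducibility problem for
avatars of cuspidal `π` in disguise; modulo reciprocity it holds (`stable_of_langlands`). Sources: [ref: Clifford1937, §1], [ref: Patrikis2019, §2.1]. -/
def StableConstituentDescent : Prop :=
  ∀ (K : Type) [Field K] [NumberField K] (n : ℕ) (hcpt : Literature.NumberTheory.Automorphic.isCompact_glFiniteIntegralLevel n K), 0 < n → ∀ (π : Literature.NumberTheory.Automorphic.CuspidalAutomorphicRepData n K hcpt), π.1.IsLAlgebraic → ∀ (L : Type) [Field L] [NumberField L] [Algebra K L], IsGalois K L → Module.finrank K L ≠ 1 → (¬ ∃ F : IntermediateField K L, F ≠ ⊥ ∧ IsGalois K ↥F ∧ IsCyclic (↥F ≃ₐ[K] ↥F) ∧ (Module.finrank K ↥F).Prime) → ∀ (ℓ : ℕ) [Fact ℓ.Prime]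 (ι : PadicAlgCl ℓ ≃+* ℂ) (r : Literature.NumberTheory.GaloisRepresentations.FramedGaloisRep L (PadicAlgCl ℓ) n), r.toGaloisRep.IsSemisimple → ¬ r.IsIrreducible → (¬ (∀ᶠ v : IsDedekindDomain.HeightOneSpectrum (NumberField.RingOfIntegers K) in cofinite, ∀ α : Multiset ℂ, π.1.HasSatakeParamAt v α → ∀ a ∈ α, ∀ b ∈ α, ∃ k : ℕ, 0 < k ∧ a ^ k = b ^ k)) → ∀ [IsGalois K L], ¬ (∀ f : Matrix (Fin n) (Fin n) (PadicAlgCl ℓ), ((∀ σ : Field.absoluteGaloisGroup L, f * ((r σ : GL (Fin n) (PadicAlgCl ℓ)) : Matrix (Fin n) (Fin n) (PadicAlgCl ℓ)) = ((r σ : GL (Fin n) (PadicAlgCl ℓ)) : Matrix (Fin n) (Fin n) (PadicAlgCl ℓ)) * f) ∧ ∀ f' : Matrix (Fin n) (Fin n) (PadicAlgCl ℓ), (∀ σ : Field.absoluteGaloisGroup L, f' * ((r σ : GL (Fin n) (PadicAlgCl ℓ)) : Matrix (Fin n) (Fin n) (PadicAlgCl ℓ)) = ((r σ : GL (Fin n)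 (PadicAlgCl ℓ)) : Matrix (Fin n) (Fin n) (PadicAlgCl ℓ)) * f') → f * f' = f' * f) → f ∈ Set.range (Matrix.scalar (Fin n) : PadicAlgCl ℓ → Matrix (Fin n) (Fin n) (PadicAlgCl ℓ))) → ¬ (∃ f : Matrix (Fin n) (Fin n) (PadicAlgCl ℓ), ((∀ σ : Field.absoluteGaloisGroup L, f * ((r σ : GL (Fin n) (PadicAlgCl ℓ)) : Matrix (Fin n) (Fin n) (PadicAlgCl ℓ)) = ((r σ : GL (Fin n) (PadicAlgCl ℓ)) : Matrix (Fin n) (Fin n) (PadicAlgCl ℓ)) * f) ∧ ∀ f' : Matrix (Fin n) (Fin n) (PadicAlgCl ℓ), (∀ σ : Field.absoluteGaloisGroup L, f' * ((r σ : GL (Fin n) (PadicAlgCl ℓ)) : Matrix (Fin n) (Fin n) (PadicAlgCl ℓ)) = ((r σ : GL (Fin n) (PadicAlgCl ℓ)) : Matrix (Fin n) (Fin n) (PadicAlgCl ℓ)) * f') → f * f' = f' * f) ∧ (∃ (τ : Field.absoluteGaloisGroup K) (P : GL (Fin n) (PadicAlgCl ℓ)), Literature.NumberTheory.GaloisRepresentations.FramedRep.conj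 P (Literature.NumberTheory.GaloisRepresentations.FramedGaloisRep.outerConj τ r) = r ∧ ((P : GL (Fin n) (PadicAlgCl ℓ)) : Matrix (Fin n) (Fin n) (PadicAlgCl ℓ)) * f * ((P⁻¹ : GL (Fin n) (PadicAlgCl ℓ)) : Matrix (Fin n) (Fin n) (PadicAlgCl ℓ)) ≠ f) ∧ (∃ F : IntermediateField K L, Module.finrank K ↥F ≤ n ∧ ∀ τ : Field.absoluteGaloisGroup K, Literature.NumberTheory.GaloisRepresentations.absGaloisQuot K L τ ∈ F.fixingSubgroup → ∀ P : GL (Fin n) (PadicAlgCl ℓ), Literature.NumberTheory.GaloisRepresentations.FramedRep.conj P (Literature.NumberTheory.GaloisRepresentations.FramedGaloisRep.outerConj τ r) = r → ((P : GL (Fin n) (PadicAlgCl ℓ)) : Matrix (Fin n) (Fin n) (PadicAlgCl ℓ)) * f * ((P⁻¹ : GL (Fin n) (PadicAlgCl ℓ)) : Matrix (Fin n) (Fin n) (PadicAlgCl ℓ)) = f)) → (∀ᶠ w : IsDedekindDomain.HeightOneSpectrum (NumberField.RingOfIntegers L) in cofinite, ∀ (v : IsDedekindDomain.HeightOneSpectrum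 (NumberField.RingOfIntegers K)) (α : Multiset ℂ), w.asIdeal.under (NumberField.RingOfIntegers K) = v.asIdeal → π.1.HasSatakeParamAt v α → r.IsUnramifiedAt w ∧ r.HasFrobCharpolyAt w (Literature.NumberTheory.Automorphic.arithFrobPolyOfSatake ι w.residueCard 1 (α.map (fun a => a ^ w.asIdeal.inertiaDeg (NumberField.RingOfIntegers K))))) → ∃ ρ : Literature.NumberTheory.GaloisRepresentations.FramedGaloisRep K (PadicAlgCl ℓ) n, ρ.toGaloisRep.IsSemisimple ∧ ∀ᶠ v : IsDedekindDomain.HeightOneSpectrum (NumberField.RingOfIntegers K) in cofinite, SatakeFrobCompatibleAt ι π.1 ρ v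

/-- **MOV · crux · DECIDED for `n ≤ 4` (vacuous, `movingAt_of_le_four`) · IDEA-NEEDED for `n ≥ 5` · S-implied** — the MOVING cell of RED°: a
central element of the commutant of `r` is moved by the Clifford action and fixed by `Gal(L/F)`, `[F:K] ≤ n` (MEANING: a constituent class of
`r` with stabiliser field `F ≠ K` of degree `≤ n`; the non-normal-induction cell `ρ = Ind_F^K`).  Strictly weaker than RED°.
Why it might fail: for `n ≥ 5` it is automorphic induction along a NON-Galois (icosahedral-type) extension `F/K` of degree `≤ n` — open;
for `n ≤ 4` it is EMPTY because a perfect-type Galois group has no subgroup of index `≤ 4` (§1, §4). Sources: [ref: Clifford1937, §2],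
[ref: Huppert1967, Kap. II §1 & Kap. IV], tree `TwinRigiditySplit.no_normal_subgroup_of_prime_index`. -/
def MovingConstituentDescent : Prop :=
  ∀ (K : Type) [Field K] [NumberField K] (n : ℕ) (hcpt : Literature.NumberTheory.Automorphic.isCompact_glFiniteIntegralLevel n K), 0 < n → ∀ (π : Literature.NumberTheory.Automorphic.CuspidalAutomorphicRepData n K hcpt), π.1.IsLAlgebraic → ∀ (L : Type) [Field L] [NumberField L] [Algebra K L], IsGalois K L → Module.finrank K L ≠ 1 → (¬ ∃ F : IntermediateField K L, F ≠ ⊥ ∧ IsGalois K ↥F ∧ IsCyclic (↥F ≃ₐ[K] ↥F) ∧ (Module.finrank K ↥F).Prime) → ∀ (ℓ : ℕ) [Fact ℓ.Prime] (ι : PadicAlgCl ℓ ≃+* ℂ) (r : Literature.NumberTheory.GaloisRepresentations.FramedGaloisRep L (PadicAlgCl ℓ) n), r.toGaloisRep.IsSemisimple → ¬ r.IsIrreducible → (¬ (∀ᶠ v : IsDedekindDomain.HeightOneSpectrum (NumberField.RingOfIntegers K) in cofinite, ∀ α : Multiset ℂ, π.1.HasSatakeParamAt v α → ∀ a ∈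 α, ∀ b ∈ α, ∃ k : ℕ, 0 < k ∧ a ^ k = b ^ k)) → ∀ [IsGalois K L], (∃ f : Matrix (Fin n) (Fin n) (PadicAlgCl ℓ), ((∀ σ : Field.absoluteGaloisGroup L, f * ((r σ : GL (Fin n) (PadicAlgCl ℓ)) : Matrix (Fin n) (Fin n) (PadicAlgCl ℓ)) = ((r σ : GL (Fin n) (PadicAlgCl ℓ)) : Matrix (Fin n) (Fin n) (PadicAlgCl ℓ)) * f) ∧ ∀ f' : Matrix (Fin n) (Fin n) (PadicAlgCl ℓ), (∀ σ : Field.absoluteGaloisGroup L, f' * ((r σ : GL (Fin n) (PadicAlgCl ℓ)) : Matrix (Fin n) (Fin n) (PadicAlgCl ℓ)) = ((r σ : GL (Fin n) (PadicAlgCl ℓ)) : Matrix (Fin n) (Fin n) (PadicAlgCl ℓ)) * f') → f * f' = f' * f) ∧ (∃ (τ : Field.absoluteGaloisGroup K) (P : GL (Fin n) (PadicAlgCl ℓ)), Literature.NumberTheory.GaloisRepresentations.FramedRep.conj P (Literature.NumberTheory.GaloisRepresentations.FramedGaloisRep.outerConj τ r) = r ∧ ((P : GL (Fin n) (PadicAlgCl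 ℓ)) : Matrix (Fin n) (Fin n) (PadicAlgCl ℓ)) * f * ((P⁻¹ : GL (Fin n) (PadicAlgCl ℓ)) : Matrix (Fin n) (Fin n) (PadicAlgCl ℓ)) ≠ f) ∧ (∃ F : IntermediateField K L, Module.finrank K ↥F ≤ n ∧ ∀ τ : Field.absoluteGaloisGroup K, Literature.NumberTheory.GaloisRepresentations.absGaloisQuot K L τ ∈ F.fixingSubgroup → ∀ P : GL (Fin n) (PadicAlgCl ℓ), Literature.NumberTheory.GaloisRepresentations.FramedRep.conj P (Literature.NumberTheory.GaloisRepresentations.FramedGaloisRep.outerConj τ r) = r → ((P : GL (Fin n) (PadicAlgCl ℓ)) : Matrix (Fin n) (Fin n) (PadicAlgCl ℓ)) * f * ((P⁻¹ : GL (Fin n) (PadicAlgCl ℓ)) : Matrix (Fin n) (Fin n) (PadicAlgCl ℓ)) = f)) → (∀ᶠ w : IsDedekindDomain.HeightOneSpectrum (NumberField.RingOfIntegers L) in cofinite, ∀ (v : IsDedekindDomain.HeightOneSpectrum (NumberField.RingOfIntegers K)) (α : Multiset ℂ), w.asIdeal.under (NumberField.RingOfIntegers K) = v.asIdeal → π.1.HasSatakeParamAt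 v α → r.IsUnramifiedAt w ∧ r.HasFrobCharpolyAt w (Literature.NumberTheory.Automorphic.arithFrobPolyOfSatake ι w.residueCard 1 (α.map (fun a => a ^ w.asIdeal.inertiaDeg (NumberField.RingOfIntegers K))))) → ∃ ρ : Literature.NumberTheory.GaloisRepresentations.FramedGaloisRep K (PadicAlgCl ℓ) n, ρ.toGaloisRep.IsSemisimple ∧ ∀ᶠ v : IsDedekindDomain.HeightOneSpectrum (NumberField.RingOfIntegers K) in cofinite, SatakeFrobCompatibleAt ι π.1 ρ v

/-- **MOV(n)** — the rank-`n` slice of MOV (the `(n : ℕ)` binder dropped; `moving_iff_forall`). -/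
def MovingConstituentDescentAt (n : ℕ) : Prop :=
  ∀ (K : Type) [Field K] [NumberField K] (hcpt : Literature.NumberTheory.Automorphic.isCompact_glFiniteIntegralLevel n K), 0 < n → ∀ (π : Literature.NumberTheory.Automorphic.CuspidalAutomorphicRepData n K hcpt), π.1.IsLAlgebraic → ∀ (L : Type) [Field L] [NumberField L] [Algebra K L], IsGalois K L → Module.finrank K L ≠ 1 → (¬ ∃ F : IntermediateField K L, F ≠ ⊥ ∧ IsGalois K ↥F ∧ IsCyclic (↥F ≃ₐ[K] ↥F) ∧ (Module.finrank K ↥F).Prime) → ∀ (ℓ : ℕ) [Fact ℓ.Prime] (ι : PadicAlgCl ℓ ≃+* ℂ) (r : Literature.NumberTheory.GaloisRepresentations.FramedGaloisRep L (PadicAlgCl ℓ) n), r.toGaloisRep.IsSemisimple → ¬ r.IsIrreducible → (¬ (∀ᶠ v : IsDedekindDomain.HeightOneSpectrum (NumberField.RingOfIntegers K) in cofinite, ∀ α : Multiset ℂ, π.1.HasSatakeParamAt v α → ∀ a ∈ α, ∀ b ∈ α, ∃ k : ℕ, 0 < k ∧ a ^ k = b ^ k)) → ∀ [IsGalois K L],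 (∃ f : Matrix (Fin n) (Fin n) (PadicAlgCl ℓ), ((∀ σ : Field.absoluteGaloisGroup L, f * ((r σ : GL (Fin n) (PadicAlgCl ℓ)) : Matrix (Fin n) (Fin n) (PadicAlgCl ℓ)) = ((r σ : GL (Fin n) (PadicAlgCl ℓ)) : Matrix (Fin n) (Fin n) (PadicAlgCl ℓ)) * f) ∧ ∀ f' : Matrix (Fin n) (Fin n) (PadicAlgCl ℓ), (∀ σ : Field.absoluteGaloisGroup L, f' * ((r σ : GL (Fin n) (PadicAlgCl ℓ)) : Matrix (Fin n) (Fin n) (PadicAlgCl ℓ)) = ((r σ : GL (Fin n) (PadicAlgCl ℓ)) : Matrix (Fin n) (Fin n) (PadicAlgCl ℓ)) * f') → f * f' = f' * f) ∧ (∃ (τ : Field.absoluteGaloisGroup K) (P : GL (Fin n) (PadicAlgCl ℓ)), Literature.NumberTheory.GaloisRepresentations.FramedRep.conj P (Literature.NumberTheory.GaloisRepresentations.FramedGaloisRep.outerConj τ r) = r ∧ ((P : GL (Fin n) (PadicAlgCl ℓ)) : Matrix (Fin n) (Fin n) (PadicAlgCl ℓ)) * f * ((P⁻¹ : GL (Fin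 n) (PadicAlgCl ℓ)) : Matrix (Fin n) (Fin n) (PadicAlgCl ℓ)) ≠ f) ∧ (∃ F : IntermediateField K L, Module.finrank K ↥F ≤ n ∧ ∀ τ : Field.absoluteGaloisGroup K, Literature.NumberTheory.GaloisRepresentations.absGaloisQuot K L τ ∈ F.fixingSubgroup → ∀ P : GL (Fin n) (PadicAlgCl ℓ), Literature.NumberTheory.GaloisRepresentations.FramedRep.conj P (Literature.NumberTheory.GaloisRepresentations.FramedGaloisRep.outerConj τ r) = r → ((P : GL (Fin n) (PadicAlgCl ℓ)) : Matrix (Fin n) (Fin n) (PadicAlgCl ℓ)) * f * ((P⁻¹ : GL (Fin n) (PadicAlgCl ℓ)) : Matrix (Fin n) (Fin n) (PadicAlgCl ℓ)) = f)) → (∀ᶠ w : IsDedekindDomain.HeightOneSpectrum (NumberField.RingOfIntegers L) in cofinite, ∀ (v : IsDedekindDomain.HeightOneSpectrum (NumberField.RingOfIntegers K)) (α : Multiset ℂ), w.asIdeal.under (NumberField.RingOfIntegers K) = v.asIdeal → π.1.HasSatakeParamAt v α → r.IsUnramifiedAt w ∧ r.HasFrobCharpolyAt w (Literature.NumberTheory.Automorphic.arithFrobPolyOfSatake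 ι w.residueCard 1 (α.map (fun a => a ^ w.asIdeal.inertiaDeg (NumberField.RingOfIntegers K))))) → ∃ ρ : Literature.NumberTheory.GaloisRepresentations.FramedGaloisRep K (PadicAlgCl ℓ) n, ρ.toGaloisRep.IsSemisimple ∧ ∀ᶠ v : IsDedekindDomain.HeightOneSpectrum (NumberField.RingOfIntegers K) in cofinite, SatakeFrobCompatibleAt ι π.1 ρ v

/-- MOV is the conjunction of its rank slices (binder swap). -/
theorem moving_iff_forall : MovingConstituentDescent ↔ ∀ n, MovingConstituentDescentAt n :=
  ⟨fun h n K _ _ hcpt => h K n hcpt, fun h K _ _ n hcpt => h n K hcpt⟩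

/-! ## §3 Kernel: `closes` BY NAME, exactness, edges -/

/-- **`closes_target` — THE TARGET BY NAME: RED° ⟸ KRON ∧ STAB ∧ MOV** (the three Clifford cells decide the residual; partition by `by_cases` on the
orbit dial; = the node's bare `closes`, not re-declared in the tree — registry-owned name). -/
theorem closes_target (hK : IsotypicPerfectDescent) (hS : StableConstituentDescent) (hM : MovingConstituentDescent) :
    Summit.Langlands.Langlands.Theses.PerfectLayerClifford.ReduciblePerfectDescent := by
  intro K _ _ n hcpt hn π hπ L _ _ _ hGal h1 hnc ℓ _ ι r hr hirr hfin hrel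
  by_cases hiso : (∀ f : Matrix (Fin n) (Fin n) (PadicAlgCl ℓ), ((∀ σ : Field.absoluteGaloisGroup L, f * ((r σ : GL (Fin n) (PadicAlgCl ℓ)) : Matrix (Fin n) (Fin n) (PadicAlgCl ℓ)) = ((r σ : GL (Fin n) (PadicAlgCl ℓ)) : Matrix (Fin n) (Fin n) (PadicAlgCl ℓ)) * f) ∧ ∀ f' : Matrix (Fin n) (Fin n) (PadicAlgCl ℓ), (∀ σ : Field.absoluteGaloisGroup L, f' * ((r σ : GL (Fin n) (PadicAlgCl ℓ)) : Matrix (Fin n) (Fin n) (PadicAlgCl ℓ)) = ((r σ : GL (Fin n) (PadicAlgCl ℓ)) : Matrix (Fin n) (Fin n) (PadicAlgCl ℓ)) * f') → f * f' = f' * f) → f ∈ Set.range (Matrix.scalar (Fin n) : PadicAlgCl ℓ → Matrix (Fin n) (Fin n) (PadicAlgCl ℓ)))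
  · exact hK K n hcpt hn π hπ L hGal h1 hnc ℓ ι r hr hirr hfin hiso hrel
  · by_cases hmov : (∃ f : Matrix (Fin n) (Fin n) (PadicAlgCl ℓ), ((∀ σ : Field.absoluteGaloisGroup L, f * ((r σ : GL (Fin n) (PadicAlgCl ℓ)) : Matrix (Fin n) (Fin n) (PadicAlgCl ℓ)) = ((r σ : GL (Fin n) (PadicAlgCl ℓ)) : Matrix (Fin n) (Fin n) (PadicAlgCl ℓ)) * f) ∧ ∀ f' : Matrix (Fin n) (Fin n) (PadicAlgCl ℓ), (∀ σ : Field.absoluteGaloisGroup L, f' * ((r σ : GL (Fin n) (PadicAlgCl ℓ)) : Matrix (Fin n) (Fin n) (PadicAlgCl ℓ)) = ((r σ : GL (Fin n) (PadicAlgCl ℓ)) : Matrix (Fin n) (Fin n) (PadicAlgCl ℓ)) * f') → f * f' = f' * f) ∧ (∃ (τ : Field.absoluteGaloisGroup K) (P : GL (Fin n) (PadicAlgCl ℓ)), Literature.NumberTheory.GaloisRepresentations.FramedRep.conj P (Literature.NumberTheory.GaloisRepresentations.FramedGaloisRep.outerConj τ r) = r ∧ ((P : GL (Fin n) (PadicAlgCl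 ℓ)) : Matrix (Fin n) (Fin n) (PadicAlgCl ℓ)) * f * ((P⁻¹ : GL (Fin n) (PadicAlgCl ℓ)) : Matrix (Fin n) (Fin n) (PadicAlgCl ℓ)) ≠ f) ∧ (∃ F : IntermediateField K L, Module.finrank K ↥F ≤ n ∧ ∀ τ : Field.absoluteGaloisGroup K, Literature.NumberTheory.GaloisRepresentations.absGaloisQuot K L τ ∈ F.fixingSubgroup → ∀ P : GL (Fin n) (PadicAlgCl ℓ), Literature.NumberTheory.GaloisRepresentations.FramedRep.conj P (Literature.NumberTheory.GaloisRepresentations.FramedGaloisRep.outerConj τ r) = r → ((P : GL (Fin n) (PadicAlgCl ℓ)) : Matrix (Fin n) (Fin n) (PadicAlgCl ℓ)) * f * ((P⁻¹ : GL (Fin n) (PadicAlgCl ℓ)) : Matrix (Fin n) (Fin n) (PadicAlgCl ℓ)) = f))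
    · exact hM K n hcpt hn π hπ L hGal h1 hnc ℓ ι r hr hirr hfin hmov hrel
    · exact hS K n hcpt hn π hπ L hGal h1 hnc ℓ ι r hr hirr hfin hiso hmov hrel

/-- RED° ⟹ KRON (drop the dial). -/
theorem isotypic_of_red (h : Summit.Langlands.Langlands.Theses.PerfectLayerClifford.ReduciblePerfectDescent) : IsotypicPerfectDescent :=
  fun K _ _ n hcpt hn π hπ L _ _ _ hGal h1 hnc ℓ _ ι r hr hirr hfin _ hrel =>
    h K n hcpt hn π hπ L hGal h1 hnc ℓ ι r hr hirr hfin hrel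

/-- RED° ⟹ STAB. -/
theorem stable_of_red (h : Summit.Langlands.Langlands.Theses.PerfectLayerClifford.ReduciblePerfectDescent) : StableConstituentDescent := by
  intro K _ _ n hcpt hn π hπ L _ _ _ hGal h1 hnc ℓ _ ι r hr hirr hfin _ _ _ hrel
  exact h K n hcpt hn π hπ L hGal h1 hnc ℓ ι r hr hirr hfin hrel

/-- RED° ⟹ MOV. -/
theorem moving_of_red (h : Summit.Langlands.Langlands.Theses.PerfectLayerClifford.ReduciblePerfectDescent) : MovingConstituentDescent := by
  intro K _ _ n hcpt hn π hπ L _ _ _ hGal h1 hnc ℓ _ ι r hr hirr hfin _ _ hrel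
  exact h K n hcpt hn π hπ L hGal h1 hnc ℓ ι r hr hirr hfin hrel

/-- **Exactness**: RED° ⟺ KRON ∧ STAB ∧ MOV. -/
theorem red_iff_pieces :
    Summit.Langlands.Langlands.Theses.PerfectLayerClifford.ReduciblePerfectDescent ↔
      (IsotypicPerfectDescent ∧ StableConstituentDescent ∧ MovingConstituentDescent) :=
  ⟨fun h => ⟨isotypic_of_red h, stable_of_red h, moving_of_red h⟩, fun h => closes_target h.1 h.2.1 h.2.2⟩

/-- RPERF ⟹ RED° (drop `¬ irreducible` and `¬PFIN`). -/
theorem red_of_perfect (h : GaloisHullLift.PerfectHullDescent) :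
    Summit.Langlands.Langlands.Theses.PerfectLayerClifford.ReduciblePerfectDescent :=
  fun K _ _ n hcpt hn π hπ L _ _ _ hGal h1 hnc ℓ _ ι r hr _ _ hrel =>
    h K n hcpt hn π hπ L hGal h1 hnc ℓ ι r hr hrel

/-- S ⟹ RED° (tree `TatePhantomLift.perfect_of_langlands`); `private`: the junction direction S ⟹ item is
recorded in the kernel for the necessity certificates below but not exported (census twin hygiene, F342 precedent). -/
private theorem red_of_langlands (hL : _root_.Langlands) :
    Summit.Langlands.Langlands.Theses.PerfectLayerClifford.ReduciblePerfectDescent :=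
  red_of_perfect (perfect_of_langlands hL)

/-- S ⟹ KRON. -/
theorem isotypic_of_langlands (hL : _root_.Langlands) : IsotypicPerfectDescent := isotypic_of_red (red_of_langlands hL)
/-- S ⟹ STAB. -/
theorem stable_of_langlands (hL : _root_.Langlands) : StableConstituentDescent := stable_of_red (red_of_langlands hL)
/-- S ⟹ MOV. -/
theorem moving_of_langlands (hL : _root_.Langlands) : MovingConstituentDescent := moving_of_red (red_of_langlands hL)

/-! ## §4 The decided rung: the moving cell is EMPTY in rank `≤ 4` -/

/-- **MOV(n) for `n ≤ 4`** — DECIDED (vacuously): the stabiliser field `F` of the moved central element would be an intermediate field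
`K < F ≤ L` with `[F:K] ≤ n ≤ 4`, which the extremal lemma forbids inside a layer without cyclic prime sub-layers. -/
theorem movingAt_of_le_four (n : ℕ) (hn4 : n ≤ 4) : MovingConstituentDescentAt n := by
  intro K _ _ hcpt hn π hπ L _ _ _ hGal h1 hnc ℓ _ ι r hr hirr hfin _ hmov hrel
  exfalso
  obtain ⟨f, hfc, ⟨τ₀, P₀, hI₀, hne⟩, F, hFn, hfix⟩ := hmov
  have hF : F ≠ ⊥ := by
    rintro rfl
    exact hne (hfix τ₀ (by rw [IntermediateField.fixingSubgroup_bot]; exact Subgroup.mem_top _) P₀ hI₀)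
  exact no_intermediateField_of_finrank_le_four hnc F hF (hFn.trans hn4)

/-- MOV ⟺ its rank-`≥ 5` slices (the rank-`≤ 4` slices are decided). -/
theorem moving_iff_from_five : MovingConstituentDescent ↔ ∀ n, 5 ≤ n → MovingConstituentDescentAt n := by
  rw [moving_iff_forall]
  refine ⟨fun h n _ => h n, fun h n => ?_⟩
  by_cases hn : n ≤ 4
  · exact movingAt_of_le_four n hn
  · exact h n (by omega)

/-- **Sharpened kernel**: RED° ⟸ KRON ∧ STAB ∧ MOV(`n ≥ 5`). -/
theorem closes_from_five (hK : IsotypicPerfectDescent) (hS : StableConstituentDescent)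
    (hM : ∀ n, 5 ≤ n → MovingConstituentDescentAt n) :
    Summit.Langlands.Langlands.Theses.PerfectLayerClifford.ReduciblePerfectDescent :=
  closes_target hK hS (moving_iff_from_five.2 hM)

/-! ## §5 Host edges -/

/-- = `closes`, spelled as the glue of the in-route split `ReduciblePerfectDescent ⟸ KRON, STAB, MOV`. -/
theorem closes_item : IsotypicPerfectDescent → StableConstituentDescent → MovingConstituentDescent →
    Summit.Langlands.Langlands.Theses.PerfectLayerClifford.ReduciblePerfectDescent := closes_target

/-- The host route's own deciding chain with RED° replaced by the three cells:
`EXT → RIGID → FINTYPE → KRON → STAB → MOV → GaloisHullLift.PerfectHullDescent` (via `PerfectLayerClifford.closes`). -/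
theorem closes_route (hE : PerfectLayerClifford.PerfectLayerExtension) (hR : PerfectLayerClifford.PerfectLayerRigidity)
    (hF : PerfectLayerClifford.FiniteTypePerfectDescent)
    (hK : IsotypicPerfectDescent) (hS : StableConstituentDescent) (hM : MovingConstituentDescent) :
    GaloisHullLift.PerfectHullDescent :=
  PerfectLayerClifford.closes hE hR hF (closes_target hK hS hM)

end Summit.Langlands.Langlands.Theorems.CliffordOrbitSplit
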